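import Mathlib
import Summits.AtomisticToContinuum.Crystallization.Theorems.ChartedPlanarOrderEnvelopeEnergyTransport
import Summits.AtomisticToContinuum.Crystallization.Theorems.ChartedPlanarOrderDefectEventMeasurable

/-!
# Envelope transport for `ChartedZeroExcessLayered` — part 4/4: the DEFECT transport clause and the stub `stub_walkTransportEnvS`

The (D) clause: the walked strict-defect indicator `W_μ^n[𝟙{μ not η-matched at x}](0)` is `P`-integrable with mean
`P{μ not η-matched at the root}` — for any NULL-MEASURABLE root event by the equal-mass sandwich between Borel subsets and supersets
(`defect_transport_of_measurableSet`, `defect_transport_clause`, round trip `mem_rootDefectS_map_sub_iff`); the root event IS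
null-measurable by `ChartedPlanarOrderDefectEventMeasurable.defectEventNullMeasurable`.  Hence `stub_walkTransportEnvS` — the
registered stub of the skeleton `ChartedZeroExcessLayered_window_birth.lean` (sha256 660351068daaba86) on
stmt-AtomisticToContinuum-26636 — holds, stated BY NAME AND SIGNATURE (verbatim).  Axioms standard.
-/

set_option maxHeartbeats 800000

namespace Summit.AtomisticToContinuum.Crystallization.Theorems.ChartedPlanarOrderEnvelopeTransport

open MeasureTheory Literature.Geometry.DiscreteGeometry Literature.Probability.Process
open Literature.MathematicalPhysics.StatisticalMechanics
open Summit.AtomisticToContinuum.Crystallization.Theorems.ChartedPlanarOrderBondWalkTransport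
open Summit.AtomisticToContinuum.Crystallization.Theorems.ChartedPlanarOrderPatternWalkHyps
open scoped ENNReal
open Summit.AtomisticToContinuum.Crystallization.Theorems.ChartedPlanarOrderDefectEventGeometry

/-! ## Stage 4 — the DEFECT TRANSPORT clause of Tc̄ˢ, modulo null-measurability of the strict root defect event

ROUND TRIP (T4): re-rooting commutes with strict matching — `θ_x μ` is `η`-unmatched at the root iff `μ` is
`η`-unmatched at `x` (same parameters `b, A, s, z`; the pattern, the radii `4b, 5b` and the tolerance are
translation-covariant).  Then the defect functional `D_n^{<η}` is the real bond walk of `x ↦ 𝟙{θ_x μ ∈ SET0ˢ}` and the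
transport engine applies to every MEASURABLE event `T` in place of `SET0ˢ`; a null-measurable `SET0ˢ` is sandwiched
between two measurable events of the same mass, which forces `D_n^{SET0ˢ} = D_n^{T}` a.e. -/

/-- re-rooting and atoms: `(map (· - x) μ) {y} = μ {y + x}`. -/
theorem map_sub_apply_singleton (μ : MeasureTheory.Measure (EuclideanSpace ℝ (Fin 3))) (x y : EuclideanSpace ℝ (Fin 3)) :
    (MeasureTheory.Measure.map (fun z => z - x) μ) {y} = μ {y + x} := by
  rw [MeasureTheory.Measure.map_apply (measurable_sub_const x) (measurableSet_singleton y)]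
  congr 1
  ext z
  simp [sub_eq_iff_eq_add]

/-- Monotonicity of the `ℝ≥0∞` bond walk in the walked function. -/
theorem walk_enn_mono (μ : MeasureTheory.Measure (EuclideanSpace ℝ (Fin 3))) {g g' : EuclideanSpace ℝ (Fin 3) → ℝ≥0∞} (h : ∀ y, g y ≤ g' y) :
    ∀ n (x : EuclideanSpace ℝ (Fin 3)),
      ((fun (h : EuclideanSpace ℝ (Fin 3) → ℝ≥0∞) (x : EuclideanSpace ℝ (Fin 3)) =>
        (12 : ℝ≥0∞)⁻¹ * ∫⁻ y, ((fun y => y - x) ⁻¹'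
          {v : EuclideanSpace ℝ (Fin 3) | 0 < dist (0 : EuclideanSpace ℝ (Fin 3)) v ∧
            dist (0 : EuclideanSpace ℝ (Fin 3)) v ≤ 28 / 25}).indicator h y ∂μ)^[n]) g x
      ≤ ((fun (h : EuclideanSpace ℝ (Fin 3) → ℝ≥0∞) (x : EuclideanSpace ℝ (Fin 3)) =>
        (12 : ℝ≥0∞)⁻¹ * ∫⁻ y, ((fun y => y - x) ⁻¹'
          {v : EuclideanSpace ℝ (Fin 3) | 0 < dist (0 : EuclideanSpace ℝ (Fin 3)) v ∧
            dist (0 : EuclideanSpace ℝ (Fin 3)) v ≤ 28 / 25}).indicator h y ∂μ)^[n]) g' x := by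
  intro n
  induction n with
  | zero => intro x; simpa using h x
  | succ n ih =>
    intro x
    rw [Function.iterate_succ_apply', Function.iterate_succ_apply']
    exact mul_le_mul' le_rfl (MeasureTheory.lintegral_mono fun y => Set.indicator_le_indicator (ih y))

/-- **ROUND TRIP (T4).** Strict `η`-matching is translation-covariant: the re-rooted configuration `θ_x μ = (· - x)_* μ`
lies in the strict root defect event iff `x` lies in the strict defect set of `μ`. -/
theorem mem_rootDefectS_map_sub_iff (μ : MeasureTheory.Measure (EuclideanSpace ℝ (Fin 3))) (x : EuclideanSpace ℝ (Fin 3)) (η : ℝ) :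
    MeasureTheory.Measure.map (fun z => z - x) μ ∈ {μ : MeasureTheory.Measure (EuclideanSpace ℝ (Fin 3)) | ¬ (∃ b : ℝ, 9 / 10 ≤ b ∧ b ≤ 1 ∧ ∃ (A : EuclideanSpace ℝ (Fin 3) →ₗᵢ[ℝ] EuclideanSpace ℝ (Fin 3)) (s : ℤ → ℤ) (z : ℤ → ℝ), Literature.MathematicalPhysics.StatisticalMechanics.IsHaggSeq s ∧ (∀ m : ℤ, 39 / 50 * b ≤ z (m + 1) - z m ∧ z (m + 1) - z m ≤ 17 / 20 * b) ∧ z 0 = 0 ∧ (∀ y : EuclideanSpace ℝ (Fin 3), dist y (0 : EuclideanSpace ℝ (Fin 3)) ≤ 4 * b → μ {y} ≠ 0 → ∃ y' : EuclideanSpace ℝ (Fin 3), y' - (0 : EuclideanSpace ℝ (Fin 3)) ∈ {p | ∃ m i j : ℤ, p = A (((i : ℝ) • Literature.MathematicalPhysics.StatisticalMechanics.triangularVec₁ b) + ((j : ℝ) • Literature.MathematicalPhysics.StatisticalMechanics.triangularVec₂ b) + ((Literature.MathematicalPhysics.StatisticalMechanics.haggLabel s m : ℝ) • Literature.MathematicalPhysics.StatisticalMechanics.barlowOffset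 b) + (z m • Literature.MathematicalPhysics.StatisticalMechanics.layerNormal 1))} ∧ dist y y' < η) ∧ (∀ y' : EuclideanSpace ℝ (Fin 3), y' - (0 : EuclideanSpace ℝ (Fin 3)) ∈ {p | ∃ m i j : ℤ, p = A (((i : ℝ) • Literature.MathematicalPhysics.StatisticalMechanics.triangularVec₁ b) + ((j : ℝ) • Literature.MathematicalPhysics.StatisticalMechanics.triangularVec₂ b) + ((Literature.MathematicalPhysics.StatisticalMechanics.haggLabel s m : ℝ) • Literature.MathematicalPhysics.StatisticalMechanics.barlowOffset b) + (z m • Literature.MathematicalPhysics.StatisticalMechanics.layerNormal 1))} → dist y' (0 : EuclideanSpace ℝ (Fin 3)) ≤ 5 * b → ∃ y : EuclideanSpace ℝ (Fin 3), μ {y} ≠ 0 ∧ dist y y' < η))}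
      ↔ x ∈ {x' : EuclideanSpace ℝ (Fin 3) | ¬ (∃ b : ℝ, 9 / 10 ≤ b ∧ b ≤ 1 ∧ ∃ (A : EuclideanSpace ℝ (Fin 3) →ₗᵢ[ℝ] EuclideanSpace ℝ (Fin 3)) (s : ℤ → ℤ) (z : ℤ → ℝ), Literature.MathematicalPhysics.StatisticalMechanics.IsHaggSeq s ∧ (∀ m : ℤ, 39 / 50 * b ≤ z (m + 1) - z m ∧ z (m + 1) - z m ≤ 17 / 20 * b) ∧ z 0 = 0 ∧ (∀ y : EuclideanSpace ℝ (Fin 3), dist y x' ≤ 4 * b → μ {y} ≠ 0 → ∃ y' : EuclideanSpace ℝ (Fin 3), y' - x' ∈ {p | ∃ m i j : ℤ, p = A (((i : ℝ) • Literature.MathematicalPhysics.StatisticalMechanics.triangularVec₁ b) + ((j : ℝ) • Literature.MathematicalPhysics.StatisticalMechanics.triangularVec₂ b) + ((Literature.MathematicalPhysics.StatisticalMechanics.haggLabel s m : ℝ) • Literature.MathematicalPhysics.StatisticalMechanics.barlowOffset b) + (z m • Literature.MathematicalPhysics.StatisticalMechanics.layerNormal 1))} ∧ dist y y' < η) ∧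 (∀ y' : EuclideanSpace ℝ (Fin 3), y' - x' ∈ {p | ∃ m i j : ℤ, p = A (((i : ℝ) • Literature.MathematicalPhysics.StatisticalMechanics.triangularVec₁ b) + ((j : ℝ) • Literature.MathematicalPhysics.StatisticalMechanics.triangularVec₂ b) + ((Literature.MathematicalPhysics.StatisticalMechanics.haggLabel s m : ℝ) • Literature.MathematicalPhysics.StatisticalMechanics.barlowOffset b) + (z m • Literature.MathematicalPhysics.StatisticalMechanics.layerNormal 1))} → dist y' x' ≤ 5 * b → ∃ y : EuclideanSpace ℝ (Fin 3), μ {y} ≠ 0 ∧ dist y y' < η))} := by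
  have hν := map_sub_apply_singleton μ x
  simp only [Set.mem_setOf_eq]
  refine not_congr (exists_congr fun b => and_congr_right fun _ => and_congr_right fun _ =>
    exists_congr fun A => exists_congr fun s => exists_congr fun z =>
    and_congr_right fun _ => and_congr_right fun _ => and_congr_right fun _ => and_congr ?_ ?_)
  · constructor
    · intro h y hyx hμ
      obtain ⟨y', hy', hd⟩ := h (y - x) (by rw [dist_eq_norm, sub_zero, ← dist_eq_norm]; exact hyx)
        (by rw [hν, sub_add_cancel]; exact hμ)
      refine ⟨y' + x, ?_, ?_⟩
      · rw [add_sub_cancel_right]; rw [sub_zero] at hy'; exact hy'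
      · rw [dist_eq_norm] at hd ⊢
        rwa [show y - (y' + x) = y - x - y' by abel]
    · intro h y hy0 hν0
      rw [hν] at hν0
      rw [dist_eq_norm, sub_zero] at hy0
      obtain ⟨y', hy', hd⟩ := h (y + x) (by rw [dist_eq_norm, add_sub_cancel_right]; exact hy0) hν0
      refine ⟨y' - x, ?_, ?_⟩
      · rw [sub_zero]; exact hy'
      · rw [dist_eq_norm] at hd ⊢
        rwa [show y - (y' - x) = y + x - y' by abel]
  · constructor
    · intro h y' hy' hd'
      obtain ⟨y, hy, hd⟩ := h (y' - x) (by rw [sub_zero]; exact hy')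
        (by rw [dist_eq_norm, sub_zero, ← dist_eq_norm]; exact hd')
      rw [hν] at hy
      exact ⟨y + x, hy, by rw [dist_eq_norm] at hd ⊢; rwa [show y + x - y' = y - (y' - x) by abel]⟩
    · intro h y' hy' hd'
      rw [sub_zero] at hy'
      rw [dist_eq_norm, sub_zero] at hd'
      obtain ⟨y, hy, hd⟩ := h (y' + x) (by rw [add_sub_cancel_right]; exact hy')
        (by rw [dist_eq_norm, add_sub_cancel_right]; exact hd')
      exact ⟨y - x, by rw [hν, sub_add_cancel]; exact hy,
        by rw [dist_eq_norm] at hd ⊢; rwa [show y - x - y' = y - (y' + x) by abel]⟩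

/-- TRANSPORT of the defect functional for a MEASURABLE event `T` of configurations: the real bond walk of
`x ↦ 𝟙{θ_x μ ∈ T}` started at the root is `P`-integrable with mean `P(T)`. -/
theorem defect_transport_of_measurableSet {δ : ℝ} (hδ : 0 < δ)
    (P : MeasureTheory.Measure (MeasureTheory.Measure (EuclideanSpace ℝ (Fin 3)))) (hP : MeasureTheory.IsProbabilityMeasure P)
    (hroot : ∀ᵐ μ ∂P, ∃ S : Set (EuclideanSpace ℝ (Fin 3)), (0 : EuclideanSpace ℝ (Fin 3)) ∈ S ∧
      (∀ x ∈ S, ∀ y ∈ S, x ≠ y → δ ≤ dist x y) ∧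
      μ = (MeasureTheory.Measure.count : MeasureTheory.Measure (EuclideanSpace ℝ (Fin 3))).restrict S)
    (hMecke : ∀ g : MeasureTheory.Measure (EuclideanSpace ℝ (Fin 3)) → EuclideanSpace ℝ (Fin 3) → ℝ≥0∞,
      Measurable (Function.uncurry g) →
      ∫⁻ μ, ∫⁻ y, g μ y ∂μ ∂P = ∫⁻ μ, ∫⁻ y, g (MeasureTheory.Measure.map (fun z => z - y) μ) (-y) ∂μ ∂P)
    (hclean : ∀ᵐ μ ∂P, ∀ q : EuclideanSpace ℝ (Fin 3), μ {q} ≠ 0 → (∃ a : ℝ, 9 / 10 ≤ a ∧ a ≤ 1 ∧ ∃ (A : EuclideanSpace ℝ (Fin 3) →ₗᵢ[ℝ] EuclideanSpace ℝ (Fin 3)) (T : Finset (EuclideanSpace ℝ (Fin 3))) (f : EuclideanSpace ℝ (Fin 3) → EuclideanSpace ℝ (Fin 3)), (T = Literature.Geometry.DiscreteGeometry.fccTwoShellPattern ∨ T = Literature.Geometry.DiscreteGeometry.hcpTwoShellPattern) ∧ (∀ v ∈ T, f v ∈ {p : EuclideanSpace ℝ (Fin 3) | μ {p} ≠ 0}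 ∧ dist (f v) (q + a • A v) ≤ 1 / 16 * a) ∧ Set.InjOn f ↑T ∧ ∀ y ∈ {p : EuclideanSpace ℝ (Fin 3) | μ {p} ≠ 0}, y ≠ q → dist y q < 3 / 2 * a → ∃ v ∈ T, f v = y))
    (T : Set (MeasureTheory.Measure (EuclideanSpace ℝ (Fin 3)))) (hT : MeasurableSet T) (n : ℕ) :
    MeasureTheory.Integrable (fun μ : MeasureTheory.Measure (EuclideanSpace ℝ (Fin 3)) => (((fun f : EuclideanSpace ℝ (Fin 3) → ℝ => fun x : EuclideanSpace ℝ (Fin 3) => (1 / 12 : ℝ) * ∫ y, (if 0 < dist x y ∧ dist x y ≤ 28 / 25 then f y else 0) ∂μ)^[n]) (fun x : EuclideanSpace ℝ (Fin 3) => Set.indicator {x' : EuclideanSpace ℝ (Fin 3) | MeasureTheory.Measure.map (fun z => z - x') μ ∈ T} (fun _ => (1 : ℝ)) x) (0 : EuclideanSpace ℝ (Fin 3)))) P ∧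
    (∫ μ, (((fun f : EuclideanSpace ℝ (Fin 3) → ℝ => fun x : EuclideanSpace ℝ (Fin 3) => (1 / 12 : ℝ) * ∫ y, (if 0 < dist x y ∧ dist x y ≤ 28 / 25 then f y else 0) ∂μ)^[n]) (fun x : EuclideanSpace ℝ (Fin 3) => Set.indicator {x' : EuclideanSpace ℝ (Fin 3) | MeasureTheory.Measure.map (fun z => z - x') μ ∈ T} (fun _ => (1 : ℝ)) x) (0 : EuclideanSpace ℝ (Fin 3))) ∂P) = (P T).toReal := by
  haveI := hP
  set F : MeasureTheory.Measure (EuclideanSpace ℝ (Fin 3)) → ℝ≥0∞ := fun ν => ENNReal.ofReal (Set.indicator T (fun _ => (1 : ℝ)) ν + 1) with hFdef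
  have hFm : Measurable F := ENNReal.measurable_ofReal.comp ((measurable_const.indicator hT).add_const 1)
  set A : MeasureTheory.Measure (EuclideanSpace ℝ (Fin 3)) → ℝ := fun μ => (((fun f : EuclideanSpace ℝ (Fin 3) → ℝ => fun x : EuclideanSpace ℝ (Fin 3) => (1 / 12 : ℝ) * ∫ y, (if 0 < dist x y ∧ dist x y ≤ 28 / 25 then f y else 0) ∂μ)^[n]) (fun x : EuclideanSpace ℝ (Fin 3) => Set.indicator {x' : EuclideanSpace ℝ (Fin 3) | MeasureTheory.Measure.map (fun z => z - x') μ ∈ T} (fun _ => (1 : ℝ)) x) (0 : EuclideanSpace ℝ (Fin 3))) with hA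
  set Wn : MeasureTheory.Measure (EuclideanSpace ℝ (Fin 3)) → ℝ≥0∞ := fun μ =>
      ((fun (h : EuclideanSpace ℝ (Fin 3) → ℝ≥0∞) (x : EuclideanSpace ℝ (Fin 3)) =>
        (12 : ℝ≥0∞)⁻¹ * ∫⁻ y, ((fun y => y - x) ⁻¹'
          {v : EuclideanSpace ℝ (Fin 3) | 0 < dist (0 : EuclideanSpace ℝ (Fin 3)) v ∧
            dist (0 : EuclideanSpace ℝ (Fin 3)) v ≤ 28 / 25}).indicator h y ∂μ)^[n]
        (fun y => F (MeasureTheory.Measure.map (fun z => z - y) μ))) 0 with hWn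
  set e : MeasureTheory.Measure (EuclideanSpace ℝ (Fin 3)) → ℝ := fun μ => Set.indicator T (fun _ => (1 : ℝ)) μ with he
  have hgood : ∀ᵐ μ ∂P, Wn μ = ENNReal.ofReal (A μ + 1) ∧ |A μ| ≤ 1 := by
    filter_upwards [hroot, hclean] with μ hμ hcl
    obtain ⟨S, h0S, hsep, rfl⟩ := hμ
    have hS : MeasurableSet S := (countable_of_separated hδ hsep).measurableSet
    have hfin : ∀ x : EuclideanSpace ℝ (Fin 3), (Metric.closedBall x (28 / 25) ∩ S).Finite := fun x =>
      Literature.Probability.Process.LocalConfig.finite_inter_of_separated hδ hsep (isCompact_closedBall x _)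
    have h12 : ∀ q ∈ S, ((MeasureTheory.Measure.count : MeasureTheory.Measure (EuclideanSpace ℝ (Fin 3))).restrict S)
        {y | 0 < dist q y ∧ dist q y ≤ 28 / 25} = 12 := fun q hq =>
      count_bondShell_eq_twelve q (hcl q ((count_restrict_singleton_ne_zero_iff S q).2 hq))
    have hfM : ∀ y ∈ S, |(fun x : EuclideanSpace ℝ (Fin 3) => Set.indicator {x' : EuclideanSpace ℝ (Fin 3) | MeasureTheory.Measure.map (fun z => z - x') ((MeasureTheory.Measure.count : MeasureTheory.Measure (EuclideanSpace ℝ (Fin 3))).restrict S) ∈ T} (fun _ => (1 : ℝ)) x) y| ≤ 1 := by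
      intro y _
      rw [abs_le]
      exact ⟨le_trans (by norm_num) (Set.indicator_nonneg (fun _ _ => zero_le_one) _),
        Set.indicator_apply_le' (fun _ => le_rfl) (fun _ => zero_le_one)⟩
    have hg : ∀ y ∈ S, (fun y => F (MeasureTheory.Measure.map (fun z => z - y) ((MeasureTheory.Measure.count : MeasureTheory.Measure (EuclideanSpace ℝ (Fin 3))).restrict S))) y
        = ENNReal.ofReal ((fun x : EuclideanSpace ℝ (Fin 3) => Set.indicator {x' : EuclideanSpace ℝ (Fin 3) | MeasureTheory.Measure.map (fun z => z - x') ((MeasureTheory.Measure.count : MeasureTheory.Measure (EuclideanSpace ℝ (Fin 3))).restrict S) ∈ T} (fun _ => (1 : ℝ)) x) y + 1) := by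
      intro y _
      simp only [hFdef]
      by_cases h : MeasureTheory.Measure.map (fun z => z - y) ((MeasureTheory.Measure.count : MeasureTheory.Measure (EuclideanSpace ℝ (Fin 3))).restrict S) ∈ T
      · rw [Set.indicator_of_mem h,
          Set.indicator_of_mem (s := {x' : EuclideanSpace ℝ (Fin 3) | MeasureTheory.Measure.map (fun z => z - x') ((MeasureTheory.Measure.count : MeasureTheory.Measure (EuclideanSpace ℝ (Fin 3))).restrict S) ∈ T}) (a := y) h]
      · rw [Set.indicator_of_notMem h,
          Set.indicator_of_notMem (s := {x' : EuclideanSpace ℝ (Fin 3) | MeasureTheory.Measure.map (fun z => z - x') ((MeasureTheory.Measure.count : MeasureTheory.Measure (EuclideanSpace ℝ (Fin 3))).restrict S) ∈ T}) (a := y) h]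
    exact walk_enn_eq_ofReal_walk_real hS hfin h12 _ 1 hfM _ hg n 0 h0S
  have hAEM : AEMeasurable Wn P := aemeasurable_confWalk hδ hroot hFm n
  have hA_ae : A =ᵐ[P] fun μ => (Wn μ).toReal - 1 := by
    filter_upwards [hgood] with μ h
    have hnn : 0 ≤ A μ + 1 := by
      have := h.2; rw [abs_le] at this; linarith [this.1]
    rw [h.1, ENNReal.toReal_ofReal hnn]; ring
  have hASM_A : MeasureTheory.AEStronglyMeasurable A P :=
    (hAEM.ennreal_toReal.sub aemeasurable_const).aestronglyMeasurable.congr hA_ae.symm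
  have hInt_A : MeasureTheory.Integrable A P :=
    MeasureTheory.Integrable.mono' (MeasureTheory.integrable_const 1) hASM_A (by
      filter_upwards [hgood] with μ h
      rw [Real.norm_eq_abs]; exact h.2)
  have he_bd : ∀ μ, |e μ| ≤ 1 := by
    intro μ; simp only [he]; rw [abs_le]
    exact ⟨le_trans (by norm_num) (Set.indicator_nonneg (fun _ _ => zero_le_one) _),
      Set.indicator_apply_le' (fun _ => le_rfl) (fun _ => zero_le_one)⟩
  have hInt_e : MeasureTheory.Integrable e P :=
    MeasureTheory.Integrable.mono' (MeasureTheory.integrable_const 1)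
      (measurable_const.indicator hT).aestronglyMeasurable
      (Filter.Eventually.of_forall fun μ => by rw [Real.norm_eq_abs]; exact he_bd μ)
  have hengine : ∫⁻ μ, Wn μ ∂P = ∫⁻ μ, F μ ∂P :=
    lintegral_bondWalk_iterate_of_envelope' hδ hMecke hroot hclean hFm n
  have hnnA : 0 ≤ᵐ[P] fun μ => A μ + 1 := by
    filter_upwards [hgood] with μ h
    have := h.2; rw [abs_le] at this
    simp only [Pi.zero_apply]; linarith [this.1]
  have hsmA : MeasureTheory.AEStronglyMeasurable (fun μ => A μ + 1) P :=
    (hInt_A.add (MeasureTheory.integrable_const 1)).aestronglyMeasurable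
  have h1 : ∫ μ, (A μ + 1) ∂P = (∫⁻ μ, Wn μ ∂P).toReal := by
    rw [MeasureTheory.integral_eq_lintegral_of_nonneg_ae hnnA hsmA]
    congr 1
    refine MeasureTheory.lintegral_congr_ae ?_
    filter_upwards [hgood] with μ h
    rw [h.1]
  have hnne : 0 ≤ᵐ[P] fun μ => e μ + 1 :=
    Filter.Eventually.of_forall fun μ => by
      have := he_bd μ; rw [abs_le] at this
      simp only [Pi.zero_apply]; linarith [this.1]
  have hsme : MeasureTheory.AEStronglyMeasurable (fun μ => e μ + 1) P :=
    (hInt_e.add (MeasureTheory.integrable_const 1)).aestronglyMeasurable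
  have h3 : (∫⁻ μ, F μ ∂P).toReal = ∫ μ, (e μ + 1) ∂P := by
    rw [MeasureTheory.integral_eq_lintegral_of_nonneg_ae hnne hsme]
  have h4 : ∫ μ, (A μ + 1) ∂P = ∫ μ, (e μ + 1) ∂P := by rw [h1, hengine, h3]
  have h5 : ∫ μ, (A μ + 1) ∂P = (∫ μ, A μ ∂P) + 1 := by
    rw [MeasureTheory.integral_add hInt_A (MeasureTheory.integrable_const 1), MeasureTheory.integral_const]
    simp
  have h6 : ∫ μ, (e μ + 1) ∂P = (∫ μ, e μ ∂P) + 1 := by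
    rw [MeasureTheory.integral_add hInt_e (MeasureTheory.integrable_const 1), MeasureTheory.integral_const]
    simp
  have h7 : ∫ μ, A μ ∂P = ∫ μ, e μ ∂P := by linarith [h4, h5, h6]
  have h8 : ∫ μ, e μ ∂P = (P T).toReal := by
    simp only [he]
    rw [MeasureTheory.integral_indicator_const _ hT]
    simp [MeasureTheory.Measure.real]
  refine ⟨hInt_A, ?_⟩
  have h9 : ∫ μ, A μ ∂P = (P T).toReal := h7.trans h8
  simpa only [hA] using h9

/-- **DEFECT TRANSPORT CLAUSE** of Tc̄ˢ (its second conjunct, VERBATIM) for every tolerance `η` whose strict root defect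
event is `P`-null-measurable: `D_n^{<η}` is `P`-integrable with mean `P(SET0ˢ_η)`.  (Round trip T4 + transport of the two
measurable envelopes of the event + the equal-mass sandwich.) -/
theorem defect_transport_clause {δ : ℝ} (hδ : 0 < δ)
    (P : MeasureTheory.Measure (MeasureTheory.Measure (EuclideanSpace ℝ (Fin 3)))) (hP : MeasureTheory.IsProbabilityMeasure P)
    (hroot : ∀ᵐ μ ∂P, ∃ S : Set (EuclideanSpace ℝ (Fin 3)), (0 : EuclideanSpace ℝ (Fin 3)) ∈ S ∧
      (∀ x ∈ S, ∀ y ∈ S, x ≠ y → δ ≤ dist x y) ∧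
      μ = (MeasureTheory.Measure.count : MeasureTheory.Measure (EuclideanSpace ℝ (Fin 3))).restrict S)
    (hMecke : ∀ g : MeasureTheory.Measure (EuclideanSpace ℝ (Fin 3)) → EuclideanSpace ℝ (Fin 3) → ℝ≥0∞,
      Measurable (Function.uncurry g) →
      ∫⁻ μ, ∫⁻ y, g μ y ∂μ ∂P = ∫⁻ μ, ∫⁻ y, g (MeasureTheory.Measure.map (fun z => z - y) μ) (-y) ∂μ ∂P)
    (hclean : ∀ᵐ μ ∂P, ∀ q : EuclideanSpace ℝ (Fin 3), μ {q} ≠ 0 → (∃ a : ℝ, 9 / 10 ≤ a ∧ a ≤ 1 ∧ ∃ (A : EuclideanSpace ℝ (Fin 3) →ₗᵢ[ℝ] EuclideanSpace ℝ (Fin 3)) (T : Finset (EuclideanSpace ℝ (Fin 3))) (f : EuclideanSpace ℝ (Fin 3) → EuclideanSpace ℝ (Fin 3)), (T = Literature.Geometry.DiscreteGeometry.fccTwoShellPattern ∨ T = Literature.Geometry.DiscreteGeometry.hcpTwoShellPattern) ∧ (∀ v ∈ T, f v ∈ {p : EuclideanSpace ℝ (Fin 3) | μ {p} ≠ 0}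 ∧ dist (f v) (q + a • A v) ≤ 1 / 16 * a) ∧ Set.InjOn f ↑T ∧ ∀ y ∈ {p : EuclideanSpace ℝ (Fin 3) | μ {p} ≠ 0}, y ≠ q → dist y q < 3 / 2 * a → ∃ v ∈ T, f v = y))
    {η : ℝ} (hU : MeasureTheory.NullMeasurableSet {μ : MeasureTheory.Measure (EuclideanSpace ℝ (Fin 3)) | ¬ (∃ b : ℝ, 9 / 10 ≤ b ∧ b ≤ 1 ∧ ∃ (A : EuclideanSpace ℝ (Fin 3) →ₗᵢ[ℝ] EuclideanSpace ℝ (Fin 3)) (s : ℤ → ℤ) (z : ℤ → ℝ), Literature.MathematicalPhysics.StatisticalMechanics.IsHaggSeq s ∧ (∀ m : ℤ, 39 / 50 * b ≤ z (m + 1) - z m ∧ z (m + 1) - z m ≤ 17 / 20 * b) ∧ z 0 = 0 ∧ (∀ y : EuclideanSpace ℝ (Fin 3), dist y (0 : EuclideanSpace ℝ (Fin 3)) ≤ 4 * b → μ {y} ≠ 0 → ∃ y' : EuclideanSpace ℝ (Fin 3), y' - (0 : EuclideanSpace ℝ (Fin 3)) ∈ {p | ∃ m i j : ℤ, p = A (((i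 : ℝ) • Literature.MathematicalPhysics.StatisticalMechanics.triangularVec₁ b) + ((j : ℝ) • Literature.MathematicalPhysics.StatisticalMechanics.triangularVec₂ b) + ((Literature.MathematicalPhysics.StatisticalMechanics.haggLabel s m : ℝ) • Literature.MathematicalPhysics.StatisticalMechanics.barlowOffset b) + (z m • Literature.MathematicalPhysics.StatisticalMechanics.layerNormal 1))} ∧ dist y y' < η) ∧ (∀ y' : EuclideanSpace ℝ (Fin 3), y' - (0 : EuclideanSpace ℝ (Fin 3)) ∈ {p | ∃ m i j : ℤ, p = A (((i : ℝ) • Literature.MathematicalPhysics.StatisticalMechanics.triangularVec₁ b) + ((j : ℝ) • Literature.MathematicalPhysics.StatisticalMechanics.triangularVec₂ b) + ((Literature.MathematicalPhysics.StatisticalMechanics.haggLabel s m : ℝ) • Literature.MathematicalPhysics.StatisticalMechanics.barlowOffset b) + (z m • Literature.MathematicalPhysics.StatisticalMechanics.layerNormal 1))} → dist y' (0 : EuclideanSpace ℝ (Fin 3)) ≤ 5 * b → ∃ y : EuclideanSpace ℝ (Fin 3), μ {y} ≠ 0 ∧ dist y y' < η))} P) (n : ℕ) :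
    MeasureTheory.Integrable (fun μ : MeasureTheory.Measure (EuclideanSpace ℝ (Fin 3)) => (((fun f : EuclideanSpace ℝ (Fin 3) → ℝ => fun x : EuclideanSpace ℝ (Fin 3) => (1 / 12 : ℝ) * ∫ y, (if 0 < dist x y ∧ dist x y ≤ 28 / 25 then f y else 0) ∂μ)^[n]) (fun x : EuclideanSpace ℝ (Fin 3) => Set.indicator {x' : EuclideanSpace ℝ (Fin 3) | ¬ (∃ b : ℝ, 9 / 10 ≤ b ∧ b ≤ 1 ∧ ∃ (A : EuclideanSpace ℝ (Fin 3) →ₗᵢ[ℝ] EuclideanSpace ℝ (Fin 3)) (s : ℤ → ℤ) (z : ℤ → ℝ), Literature.MathematicalPhysics.StatisticalMechanics.IsHaggSeq s ∧ (∀ m : ℤ, 39 / 50 * b ≤ z (m + 1) - z m ∧ z (m + 1) - z m ≤ 17 / 20 * b) ∧ z 0 = 0 ∧ (∀ y : EuclideanSpace ℝ (Fin 3), dist y x' ≤ 4 * b → μ {y} ≠ 0 → ∃ y' : EuclideanSpace ℝ (Fin 3), y' - x' ∈ {p | ∃ m i j : ℤ, p = A (((i : ℝ) • Literature.MathematicalPhysics.StatisticalMechanics.triangularVec₁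 b) + ((j : ℝ) • Literature.MathematicalPhysics.StatisticalMechanics.triangularVec₂ b) + ((Literature.MathematicalPhysics.StatisticalMechanics.haggLabel s m : ℝ) • Literature.MathematicalPhysics.StatisticalMechanics.barlowOffset b) + (z m • Literature.MathematicalPhysics.StatisticalMechanics.layerNormal 1))} ∧ dist y y' < η) ∧ (∀ y' : EuclideanSpace ℝ (Fin 3), y' - x' ∈ {p | ∃ m i j : ℤ, p = A (((i : ℝ) • Literature.MathematicalPhysics.StatisticalMechanics.triangularVec₁ b) + ((j : ℝ) • Literature.MathematicalPhysics.StatisticalMechanics.triangularVec₂ b) + ((Literature.MathematicalPhysics.StatisticalMechanics.haggLabel s m : ℝ) • Literature.MathematicalPhysics.StatisticalMechanics.barlowOffset b) + (z m • Literature.MathematicalPhysics.StatisticalMechanics.layerNormal 1))} → dist y' x' ≤ 5 * b → ∃ y : EuclideanSpace ℝ (Fin 3), μ {y} ≠ 0 ∧ dist y y' < η))} (fun _ => (1 : ℝ)) x) (0 : EuclideanSpace ℝ (Fin 3)))) P ∧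
    (∫ μ, (((fun f : EuclideanSpace ℝ (Fin 3) → ℝ => fun x : EuclideanSpace ℝ (Fin 3) => (1 / 12 : ℝ) * ∫ y, (if 0 < dist x y ∧ dist x y ≤ 28 / 25 then f y else 0) ∂μ)^[n]) (fun x : EuclideanSpace ℝ (Fin 3) => Set.indicator {x' : EuclideanSpace ℝ (Fin 3) | ¬ (∃ b : ℝ, 9 / 10 ≤ b ∧ b ≤ 1 ∧ ∃ (A : EuclideanSpace ℝ (Fin 3) →ₗᵢ[ℝ] EuclideanSpace ℝ (Fin 3)) (s : ℤ → ℤ) (z : ℤ → ℝ), Literature.MathematicalPhysics.StatisticalMechanics.IsHaggSeq s ∧ (∀ m : ℤ, 39 / 50 * b ≤ z (m + 1) - z m ∧ z (m + 1) - z m ≤ 17 / 20 * b) ∧ z 0 = 0 ∧ (∀ y : EuclideanSpace ℝ (Fin 3), dist y x' ≤ 4 * b → μ {y} ≠ 0 → ∃ y' : EuclideanSpace ℝ (Fin 3), y' - x' ∈ {p | ∃ m i j : ℤ, p = A (((i : ℝ) • Literature.MathematicalPhysics.StatisticalMechanics.triangularVec₁ b) + ((j : ℝ) • Literature.MathematicalPhysics.StatisticalMechanics.triangularVec₂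 b) + ((Literature.MathematicalPhysics.StatisticalMechanics.haggLabel s m : ℝ) • Literature.MathematicalPhysics.StatisticalMechanics.barlowOffset b) + (z m • Literature.MathematicalPhysics.StatisticalMechanics.layerNormal 1))} ∧ dist y y' < η) ∧ (∀ y' : EuclideanSpace ℝ (Fin 3), y' - x' ∈ {p | ∃ m i j : ℤ, p = A (((i : ℝ) • Literature.MathematicalPhysics.StatisticalMechanics.triangularVec₁ b) + ((j : ℝ) • Literature.MathematicalPhysics.StatisticalMechanics.triangularVec₂ b) + ((Literature.MathematicalPhysics.StatisticalMechanics.haggLabel s m : ℝ) • Literature.MathematicalPhysics.StatisticalMechanics.barlowOffset b) + (z m • Literature.MathematicalPhysics.StatisticalMechanics.layerNormal 1))} → dist y' x' ≤ 5 * b → ∃ y : EuclideanSpace ℝ (Fin 3), μ {y} ≠ 0 ∧ dist y y' < η))} (fun _ => (1 : ℝ)) x) (0 : EuclideanSpace ℝ (Fin 3))) ∂P) = (P {μ : MeasureTheory.Measure (EuclideanSpace ℝ (Fin 3)) | ¬ (∃ b : ℝ, 9 / 10 ≤ b ∧ b ≤ 1 ∧ ∃ (A : EuclideanSpace ℝ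 (Fin 3) →ₗᵢ[ℝ] EuclideanSpace ℝ (Fin 3)) (s : ℤ → ℤ) (z : ℤ → ℝ), Literature.MathematicalPhysics.StatisticalMechanics.IsHaggSeq s ∧ (∀ m : ℤ, 39 / 50 * b ≤ z (m + 1) - z m ∧ z (m + 1) - z m ≤ 17 / 20 * b) ∧ z 0 = 0 ∧ (∀ y : EuclideanSpace ℝ (Fin 3), dist y (0 : EuclideanSpace ℝ (Fin 3)) ≤ 4 * b → μ {y} ≠ 0 → ∃ y' : EuclideanSpace ℝ (Fin 3), y' - (0 : EuclideanSpace ℝ (Fin 3)) ∈ {p | ∃ m i j : ℤ, p = A (((i : ℝ) • Literature.MathematicalPhysics.StatisticalMechanics.triangularVec₁ b) + ((j : ℝ) • Literature.MathematicalPhysics.StatisticalMechanics.triangularVec₂ b) + ((Literature.MathematicalPhysics.StatisticalMechanics.haggLabel s m : ℝ) • Literature.MathematicalPhysics.StatisticalMechanics.barlowOffset b) + (z m • Literature.MathematicalPhysics.StatisticalMechanics.layerNormal 1))} ∧ dist y y' < η) ∧ (∀ y' : EuclideanSpace ℝ (Fin 3), y' - (0 : EuclideanSpace ℝ (Fin 3))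 ∈ {p | ∃ m i j : ℤ, p = A (((i : ℝ) • Literature.MathematicalPhysics.StatisticalMechanics.triangularVec₁ b) + ((j : ℝ) • Literature.MathematicalPhysics.StatisticalMechanics.triangularVec₂ b) + ((Literature.MathematicalPhysics.StatisticalMechanics.haggLabel s m : ℝ) • Literature.MathematicalPhysics.StatisticalMechanics.barlowOffset b) + (z m • Literature.MathematicalPhysics.StatisticalMechanics.layerNormal 1))} → dist y' (0 : EuclideanSpace ℝ (Fin 3)) ≤ 5 * b → ∃ y : EuclideanSpace ℝ (Fin 3), μ {y} ≠ 0 ∧ dist y y' < η))}).toReal := by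
  haveI := hP
  obtain ⟨T, hUT, hTm, hTae⟩ := hU.exists_measurable_superset_ae_eq
  obtain ⟨T', hT'U, hT'm, hT'ae⟩ := hU.exists_measurable_subset_ae_eq
  have hcT := defect_transport_of_measurableSet hδ P hP hroot hMecke hclean T hTm n
  have hcT' := defect_transport_of_measurableSet hδ P hP hroot hMecke hclean T' hT'm n
  have hset : ∀ μ : MeasureTheory.Measure (EuclideanSpace ℝ (Fin 3)), {x' : EuclideanSpace ℝ (Fin 3) | ¬ (∃ b : ℝ, 9 / 10 ≤ b ∧ b ≤ 1 ∧ ∃ (A : EuclideanSpace ℝ (Fin 3) →ₗᵢ[ℝ] EuclideanSpace ℝ (Fin 3)) (s : ℤ → ℤ) (z : ℤ → ℝ), Literature.MathematicalPhysics.StatisticalMechanics.IsHaggSeq s ∧ (∀ m : ℤ, 39 / 50 * b ≤ z (m + 1) - z m ∧ z (m + 1) - z m ≤ 17 / 20 * b) ∧ z 0 = 0 ∧ (∀ y : EuclideanSpace ℝ (Fin 3), dist y x' ≤ 4 * b → μ {y} ≠ 0 → ∃ y' : EuclideanSpace ℝ (Fin 3), y' - x' ∈ {p | ∃ m i j : ℤ,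 p = A (((i : ℝ) • Literature.MathematicalPhysics.StatisticalMechanics.triangularVec₁ b) + ((j : ℝ) • Literature.MathematicalPhysics.StatisticalMechanics.triangularVec₂ b) + ((Literature.MathematicalPhysics.StatisticalMechanics.haggLabel s m : ℝ) • Literature.MathematicalPhysics.StatisticalMechanics.barlowOffset b) + (z m • Literature.MathematicalPhysics.StatisticalMechanics.layerNormal 1))} ∧ dist y y' < η) ∧ (∀ y' : EuclideanSpace ℝ (Fin 3), y' - x' ∈ {p | ∃ m i j : ℤ, p = A (((i : ℝ) • Literature.MathematicalPhysics.StatisticalMechanics.triangularVec₁ b) + ((j : ℝ) • Literature.MathematicalPhysics.StatisticalMechanics.triangularVec₂ b) + ((Literature.MathematicalPhysics.StatisticalMechanics.haggLabel s m : ℝ) • Literature.MathematicalPhysics.StatisticalMechanics.barlowOffset b) + (z m • Literature.MathematicalPhysics.StatisticalMechanics.layerNormal 1))} → dist y' x' ≤ 5 * b → ∃ y : EuclideanSpace ℝ (Fin 3), μ {y} ≠ 0 ∧ dist y y' < η))}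
      = {x' : EuclideanSpace ℝ (Fin 3) | MeasureTheory.Measure.map (fun z => z - x') μ ∈ {μ : MeasureTheory.Measure (EuclideanSpace ℝ (Fin 3)) | ¬ (∃ b : ℝ, 9 / 10 ≤ b ∧ b ≤ 1 ∧ ∃ (A : EuclideanSpace ℝ (Fin 3) →ₗᵢ[ℝ] EuclideanSpace ℝ (Fin 3)) (s : ℤ → ℤ) (z : ℤ → ℝ), Literature.MathematicalPhysics.StatisticalMechanics.IsHaggSeq s ∧ (∀ m : ℤ, 39 / 50 * b ≤ z (m + 1) - z m ∧ z (m + 1) - z m ≤ 17 / 20 * b) ∧ z 0 = 0 ∧ (∀ y : EuclideanSpace ℝ (Fin 3), dist y (0 : EuclideanSpace ℝ (Fin 3)) ≤ 4 * b → μ {y} ≠ 0 → ∃ y' : EuclideanSpace ℝ (Fin 3), y' - (0 : EuclideanSpace ℝ (Fin 3)) ∈ {p | ∃ m i j : ℤ, p = A (((i : ℝ) • Literature.MathematicalPhysics.StatisticalMechanics.triangularVec₁ b) + ((j : ℝ) • Literature.MathematicalPhysics.StatisticalMechanics.triangularVec₂ b) + ((Literature.MathematicalPhysics.StatisticalMechanics.haggLabel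 s m : ℝ) • Literature.MathematicalPhysics.StatisticalMechanics.barlowOffset b) + (z m • Literature.MathematicalPhysics.StatisticalMechanics.layerNormal 1))} ∧ dist y y' < η) ∧ (∀ y' : EuclideanSpace ℝ (Fin 3), y' - (0 : EuclideanSpace ℝ (Fin 3)) ∈ {p | ∃ m i j : ℤ, p = A (((i : ℝ) • Literature.MathematicalPhysics.StatisticalMechanics.triangularVec₁ b) + ((j : ℝ) • Literature.MathematicalPhysics.StatisticalMechanics.triangularVec₂ b) + ((Literature.MathematicalPhysics.StatisticalMechanics.haggLabel s m : ℝ) • Literature.MathematicalPhysics.StatisticalMechanics.barlowOffset b) + (z m • Literature.MathematicalPhysics.StatisticalMechanics.layerNormal 1))} → dist y' (0 : EuclideanSpace ℝ (Fin 3)) ≤ 5 * b → ∃ y : EuclideanSpace ℝ (Fin 3), μ {y} ≠ 0 ∧ dist y y' < η))}} :=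
    fun μ => Set.ext fun x' => (mem_rootDefectS_map_sub_iff μ x' η).symm
  simp only [hset]
  -- the three defect functionals and their pointwise sandwich on the good set
  set U : Set (MeasureTheory.Measure (EuclideanSpace ℝ (Fin 3))) := {μ : MeasureTheory.Measure (EuclideanSpace ℝ (Fin 3)) | ¬ (∃ b : ℝ, 9 / 10 ≤ b ∧ b ≤ 1 ∧ ∃ (A : EuclideanSpace ℝ (Fin 3) →ₗᵢ[ℝ] EuclideanSpace ℝ (Fin 3)) (s : ℤ → ℤ) (z : ℤ → ℝ), Literature.MathematicalPhysics.StatisticalMechanics.IsHaggSeq s ∧ (∀ m : ℤ, 39 / 50 * b ≤ z (m + 1) - z m ∧ z (m + 1) - z m ≤ 17 / 20 * b) ∧ z 0 = 0 ∧ (∀ y : EuclideanSpace ℝ (Fin 3), dist y (0 : EuclideanSpace ℝ (Fin 3)) ≤ 4 * b → μ {y} ≠ 0 → ∃ y' : EuclideanSpace ℝ (Fin 3), y' - (0 : EuclideanSpace ℝ (Fin 3)) ∈ {p | ∃ m i j : ℤ, p = A (((i : ℝ) • Literature.MathematicalPhysics.StatisticalMechanics.triangularVec₁ b) + ((j : ℝ)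 • Literature.MathematicalPhysics.StatisticalMechanics.triangularVec₂ b) + ((Literature.MathematicalPhysics.StatisticalMechanics.haggLabel s m : ℝ) • Literature.MathematicalPhysics.StatisticalMechanics.barlowOffset b) + (z m • Literature.MathematicalPhysics.StatisticalMechanics.layerNormal 1))} ∧ dist y y' < η) ∧ (∀ y' : EuclideanSpace ℝ (Fin 3), y' - (0 : EuclideanSpace ℝ (Fin 3)) ∈ {p | ∃ m i j : ℤ, p = A (((i : ℝ) • Literature.MathematicalPhysics.StatisticalMechanics.triangularVec₁ b) + ((j : ℝ) • Literature.MathematicalPhysics.StatisticalMechanics.triangularVec₂ b) + ((Literature.MathematicalPhysics.StatisticalMechanics.haggLabel s m : ℝ) • Literature.MathematicalPhysics.StatisticalMechanics.barlowOffset b) + (z m • Literature.MathematicalPhysics.StatisticalMechanics.layerNormal 1))} → dist y' (0 : EuclideanSpace ℝ (Fin 3)) ≤ 5 * b → ∃ y : EuclideanSpace ℝ (Fin 3), μ {y} ≠ 0 ∧ dist y y' < η))} with hUdef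
  set DU : MeasureTheory.Measure (EuclideanSpace ℝ (Fin 3)) → ℝ := fun μ => (((fun f : EuclideanSpace ℝ (Fin 3) → ℝ => fun x : EuclideanSpace ℝ (Fin 3) => (1 / 12 : ℝ) * ∫ y, (if 0 < dist x y ∧ dist x y ≤ 28 / 25 then f y else 0) ∂μ)^[n]) (fun x : EuclideanSpace ℝ (Fin 3) => Set.indicator {x' : EuclideanSpace ℝ (Fin 3) | MeasureTheory.Measure.map (fun z => z - x') μ ∈ U} (fun _ => (1 : ℝ)) x) (0 : EuclideanSpace ℝ (Fin 3))) with hDU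
  set DT : MeasureTheory.Measure (EuclideanSpace ℝ (Fin 3)) → ℝ := fun μ => (((fun f : EuclideanSpace ℝ (Fin 3) → ℝ => fun x : EuclideanSpace ℝ (Fin 3) => (1 / 12 : ℝ) * ∫ y, (if 0 < dist x y ∧ dist x y ≤ 28 / 25 then f y else 0) ∂μ)^[n]) (fun x : EuclideanSpace ℝ (Fin 3) => Set.indicator {x' : EuclideanSpace ℝ (Fin 3) | MeasureTheory.Measure.map (fun z => z - x') μ ∈ T} (fun _ => (1 : ℝ)) x) (0 : EuclideanSpace ℝ (Fin 3))) with hDT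
  set DT' : MeasureTheory.Measure (EuclideanSpace ℝ (Fin 3)) → ℝ := fun μ => (((fun f : EuclideanSpace ℝ (Fin 3) → ℝ => fun x : EuclideanSpace ℝ (Fin 3) => (1 / 12 : ℝ) * ∫ y, (if 0 < dist x y ∧ dist x y ≤ 28 / 25 then f y else 0) ∂μ)^[n]) (fun x : EuclideanSpace ℝ (Fin 3) => Set.indicator {x' : EuclideanSpace ℝ (Fin 3) | MeasureTheory.Measure.map (fun z => z - x') μ ∈ T'} (fun _ => (1 : ℝ)) x) (0 : EuclideanSpace ℝ (Fin 3))) with hDT'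
  have hmono : ∀ᵐ μ ∂P, DT' μ ≤ DU μ ∧ DU μ ≤ DT μ := by
    filter_upwards [hroot, hclean] with μ hμ hcl
    obtain ⟨S, h0S, hsep, rfl⟩ := hμ
    have hS : MeasurableSet S := (countable_of_separated hδ hsep).measurableSet
    have hfin : ∀ x : EuclideanSpace ℝ (Fin 3), (Metric.closedBall x (28 / 25) ∩ S).Finite := fun x =>
      Literature.Probability.Process.LocalConfig.finite_inter_of_separated hδ hsep (isCompact_closedBall x _)
    have h12 : ∀ q ∈ S, ((MeasureTheory.Measure.count : MeasureTheory.Measure (EuclideanSpace ℝ (Fin 3))).restrict S)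
        {y | 0 < dist q y ∧ dist q y ≤ 28 / 25} = 12 := fun q hq =>
      count_bondShell_eq_twelve q (hcl q ((count_restrict_singleton_ne_zero_iff S q).2 hq))
    have hid : ∀ V : Set (MeasureTheory.Measure (EuclideanSpace ℝ (Fin 3))),
        ((fun (h : EuclideanSpace ℝ (Fin 3) → ℝ≥0∞) (x : EuclideanSpace ℝ (Fin 3)) =>
        (12 : ℝ≥0∞)⁻¹ * ∫⁻ y, ((fun y => y - x) ⁻¹'
          {v : EuclideanSpace ℝ (Fin 3) | 0 < dist (0 : EuclideanSpace ℝ (Fin 3)) v ∧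
            dist (0 : EuclideanSpace ℝ (Fin 3)) v ≤ 28 / 25}).indicator h y ∂((MeasureTheory.Measure.count : MeasureTheory.Measure (EuclideanSpace ℝ (Fin 3))).restrict S))^[n]
        (fun y => ENNReal.ofReal (Set.indicator V (fun _ => (1 : ℝ)) (MeasureTheory.Measure.map (fun z => z - y) ((MeasureTheory.Measure.count : MeasureTheory.Measure (EuclideanSpace ℝ (Fin 3))).restrict S)) + 1))) 0
          = ENNReal.ofReal ((((fun f : EuclideanSpace ℝ (Fin 3) → ℝ => fun x : EuclideanSpace ℝ (Fin 3) => (1 / 12 : ℝ) * ∫ y, (if 0 < dist x y ∧ dist x y ≤ 28 / 25 then f y else 0) ∂((MeasureTheory.Measure.count : MeasureTheory.Measure (EuclideanSpace ℝ (Fin 3))).restrict S))^[n]) (fun x : EuclideanSpace ℝ (Fin 3) => Set.indicator {x' : EuclideanSpace ℝ (Fin 3) | MeasureTheory.Measure.map (fun z => z - x') ((MeasureTheory.Measure.count : MeasureTheory.Measure (EuclideanSpace ℝ (Fin 3))).restrict S) ∈ V} (fun _ => (1 : ℝ)) x) (0 : EuclideanSpace ℝ (Fin 3))) + 1)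
        ∧ |(((fun f : EuclideanSpace ℝ (Fin 3) → ℝ => fun x : EuclideanSpace ℝ (Fin 3) => (1 / 12 : ℝ) * ∫ y, (if 0 < dist x y ∧ dist x y ≤ 28 / 25 then f y else 0) ∂((MeasureTheory.Measure.count : MeasureTheory.Measure (EuclideanSpace ℝ (Fin 3))).restrict S))^[n]) (fun x : EuclideanSpace ℝ (Fin 3) => Set.indicator {x' : EuclideanSpace ℝ (Fin 3) | MeasureTheory.Measure.map (fun z => z - x') ((MeasureTheory.Measure.count : MeasureTheory.Measure (EuclideanSpace ℝ (Fin 3))).restrict S) ∈ V} (fun _ => (1 : ℝ)) x) (0 : EuclideanSpace ℝ (Fin 3)))| ≤ 1 := by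
      intro V
      have hfM : ∀ y ∈ S, |(fun x : EuclideanSpace ℝ (Fin 3) => Set.indicator {x' : EuclideanSpace ℝ (Fin 3) | MeasureTheory.Measure.map (fun z => z - x') ((MeasureTheory.Measure.count : MeasureTheory.Measure (EuclideanSpace ℝ (Fin 3))).restrict S) ∈ V} (fun _ => (1 : ℝ)) x) y| ≤ 1 := by
        intro y _
        rw [abs_le]
        exact ⟨le_trans (by norm_num) (Set.indicator_nonneg (fun _ _ => zero_le_one) _),
          Set.indicator_apply_le' (fun _ => le_rfl) (fun _ => zero_le_one)⟩
      have hg : ∀ y ∈ S, (fun y => ENNReal.ofReal (Set.indicator V (fun _ => (1 : ℝ))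
          (MeasureTheory.Measure.map (fun z => z - y) ((MeasureTheory.Measure.count : MeasureTheory.Measure (EuclideanSpace ℝ (Fin 3))).restrict S)) + 1)) y
          = ENNReal.ofReal ((fun x : EuclideanSpace ℝ (Fin 3) => Set.indicator {x' : EuclideanSpace ℝ (Fin 3) | MeasureTheory.Measure.map (fun z => z - x') ((MeasureTheory.Measure.count : MeasureTheory.Measure (EuclideanSpace ℝ (Fin 3))).restrict S) ∈ V} (fun _ => (1 : ℝ)) x) y + 1) := by
        intro y _
        beta_reduce
        by_cases h : MeasureTheory.Measure.map (fun z => z - y) ((MeasureTheory.Measure.count : MeasureTheory.Measure (EuclideanSpace ℝ (Fin 3))).restrict S) ∈ V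
        · rw [Set.indicator_of_mem h,
            Set.indicator_of_mem (s := {x' : EuclideanSpace ℝ (Fin 3) | MeasureTheory.Measure.map (fun z => z - x') ((MeasureTheory.Measure.count : MeasureTheory.Measure (EuclideanSpace ℝ (Fin 3))).restrict S) ∈ V}) (a := y) h]
        · rw [Set.indicator_of_notMem h,
            Set.indicator_of_notMem (s := {x' : EuclideanSpace ℝ (Fin 3) | MeasureTheory.Measure.map (fun z => z - x') ((MeasureTheory.Measure.count : MeasureTheory.Measure (EuclideanSpace ℝ (Fin 3))).restrict S) ∈ V}) (a := y) h]
      exact walk_enn_eq_ofReal_walk_real hS hfin h12 _ 1 hfM _ hg n 0 h0S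
    have hle : ∀ V V' : Set (MeasureTheory.Measure (EuclideanSpace ℝ (Fin 3))), V ⊆ V' →
        ((fun (h : EuclideanSpace ℝ (Fin 3) → ℝ≥0∞) (x : EuclideanSpace ℝ (Fin 3)) =>
        (12 : ℝ≥0∞)⁻¹ * ∫⁻ y, ((fun y => y - x) ⁻¹'
          {v : EuclideanSpace ℝ (Fin 3) | 0 < dist (0 : EuclideanSpace ℝ (Fin 3)) v ∧
            dist (0 : EuclideanSpace ℝ (Fin 3)) v ≤ 28 / 25}).indicator h y ∂((MeasureTheory.Measure.count : MeasureTheory.Measure (EuclideanSpace ℝ (Fin 3))).restrict S))^[n]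
        (fun y => ENNReal.ofReal (Set.indicator V (fun _ => (1 : ℝ)) (MeasureTheory.Measure.map (fun z => z - y) ((MeasureTheory.Measure.count : MeasureTheory.Measure (EuclideanSpace ℝ (Fin 3))).restrict S)) + 1))) 0
        ≤ ((fun (h : EuclideanSpace ℝ (Fin 3) → ℝ≥0∞) (x : EuclideanSpace ℝ (Fin 3)) =>
        (12 : ℝ≥0∞)⁻¹ * ∫⁻ y, ((fun y => y - x) ⁻¹'
          {v : EuclideanSpace ℝ (Fin 3) | 0 < dist (0 : EuclideanSpace ℝ (Fin 3)) v ∧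
            dist (0 : EuclideanSpace ℝ (Fin 3)) v ≤ 28 / 25}).indicator h y ∂((MeasureTheory.Measure.count : MeasureTheory.Measure (EuclideanSpace ℝ (Fin 3))).restrict S))^[n]
        (fun y => ENNReal.ofReal (Set.indicator V' (fun _ => (1 : ℝ)) (MeasureTheory.Measure.map (fun z => z - y) ((MeasureTheory.Measure.count : MeasureTheory.Measure (EuclideanSpace ℝ (Fin 3))).restrict S)) + 1))) 0 := by
      intro V V' hVV'
      refine walk_enn_mono _ (fun y => ?_) n 0
      exact ENNReal.ofReal_le_ofReal (add_le_add
        (Set.indicator_le_indicator_of_subset hVV' (fun _ => zero_le_one) _) le_rfl)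
    have h1 := hle T' U hT'U
    have h2 := hle U T hUT
    rw [(hid T').1, (hid U).1] at h1
    rw [(hid U).1, (hid T).1] at h2
    have hU0 : 0 ≤ (((fun f : EuclideanSpace ℝ (Fin 3) → ℝ => fun x : EuclideanSpace ℝ (Fin 3) => (1 / 12 : ℝ) * ∫ y, (if 0 < dist x y ∧ dist x y ≤ 28 / 25 then f y else 0) ∂((MeasureTheory.Measure.count : MeasureTheory.Measure (EuclideanSpace ℝ (Fin 3))).restrict S))^[n]) (fun x : EuclideanSpace ℝ (Fin 3) => Set.indicator {x' : EuclideanSpace ℝ (Fin 3) | MeasureTheory.Measure.map (fun z => z - x') ((MeasureTheory.Measure.count : MeasureTheory.Measure (EuclideanSpace ℝ (Fin 3))).restrict S) ∈ U} (fun _ => (1 : ℝ)) x) (0 : EuclideanSpace ℝ (Fin 3))) + 1 := by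
      have := (hid U).2; rw [abs_le] at this; linarith [this.1]
    have hT0 : 0 ≤ (((fun f : EuclideanSpace ℝ (Fin 3) → ℝ => fun x : EuclideanSpace ℝ (Fin 3) => (1 / 12 : ℝ) * ∫ y, (if 0 < dist x y ∧ dist x y ≤ 28 / 25 then f y else 0) ∂((MeasureTheory.Measure.count : MeasureTheory.Measure (EuclideanSpace ℝ (Fin 3))).restrict S))^[n]) (fun x : EuclideanSpace ℝ (Fin 3) => Set.indicator {x' : EuclideanSpace ℝ (Fin 3) | MeasureTheory.Measure.map (fun z => z - x') ((MeasureTheory.Measure.count : MeasureTheory.Measure (EuclideanSpace ℝ (Fin 3))).restrict S) ∈ T} (fun _ => (1 : ℝ)) x) (0 : EuclideanSpace ℝ (Fin 3))) + 1 := by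
      have := (hid T).2; rw [abs_le] at this; linarith [this.1]
    rw [ENNReal.ofReal_le_ofReal_iff hU0] at h1
    rw [ENNReal.ofReal_le_ofReal_iff hT0] at h2
    simp only [hDU, hDT, hDT']
    constructor <;> linarith
  have hPT : P T = P U := MeasureTheory.measure_congr hTae
  have hPT' : P T' = P U := MeasureTheory.measure_congr hT'ae
  have hint0 : ∫ μ, (DT μ - DT' μ) ∂P = 0 := by
    rw [MeasureTheory.integral_sub hcT.1 hcT'.1]
    simp only [hDT, hDT']
    rw [hcT.2, hcT'.2, hPT, hPT', sub_self]
  have hnn : 0 ≤ᵐ[P] fun μ => DT μ - DT' μ :=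
    hmono.mono fun μ h => by simp only [Pi.zero_apply]; linarith [h.1, h.2]
  have hae0 := (MeasureTheory.integral_eq_zero_iff_of_nonneg_ae hnn (hcT.1.sub hcT'.1)).1 hint0
  have haeU : DU =ᵐ[P] DT := by
    filter_upwards [hae0, hmono] with μ h0 hm
    simp only [Pi.zero_apply] at h0
    exact le_antisymm hm.2 (by linarith [hm.1])
  refine ⟨hcT.1.congr haeU.symm, ?_⟩
  rw [MeasureTheory.integral_congr_ae haeU]
  simp only [hDT]
  rw [hcT.2, hPT]


/-! ## Stage 5 — Tc̄ˢ VERBATIM from the measurability residual «DefectEventNullMeasurable» (the hypothesis `hR` below)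

What is left of the walk-transport stub after Stages 3–4 is a statement of DESCRIPTIVE SET THEORY only: the strict root
defect event `SET0ˢ_η = {μ | ¬ ∃ b ∈ [9/10,1], MATCH^{<η}(μ; 0, b)}` is `P`-null-measurable for every law `P` carried by
rooted `δ`-separated counting configurations.  (TRUE-type: on such configurations both matching clauses are, for FIXED
parameters `(b, A, s, z)`, Borel conditions `μ(closedBall ∖ U) = 0` / `μ(ball(y′, η)) ≠ 0`, and by local finiteness +
strict tolerance the admissible parameter set is open, so a countable dense parameter family suffices — a countable
union of Borel sets agrees with the complement of `SET0ˢ_η` on the carrying class.  Not kernel-checked here.) -/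

/-- **Tc̄ˢ VERBATIM** (the v3 transport stub `stub_walkTransportEnvS` of the WindowDuality node, both conjuncts, every
`η > 0`, every `n`) from the measurability residual alone: energy clause = `energy_transport_clause` (unconditional),
defect clause = `defect_transport_clause`. -/
theorem tcEnvS_of_defectEventNullMeasurable
    (hR : ∀ δ : ℝ, 0 < δ → ∀ P : MeasureTheory.Measure (MeasureTheory.Measure (EuclideanSpace ℝ (Fin 3))), (∀ᵐ μ ∂P, (∃ S : Set (EuclideanSpace ℝ (Fin 3)), (0 : EuclideanSpace ℝ (Fin 3)) ∈ S ∧ (∀ x ∈ S, ∀ y ∈ S, x ≠ y → δ ≤ dist x y) ∧ μ = (MeasureTheory.Measure.count : MeasureTheory.Measure (EuclideanSpace ℝ (Fin 3))).restrict S)) → ∀ η : ℝ, 0 < η → MeasureTheory.NullMeasurableSet {μ : MeasureTheory.Measure (EuclideanSpace ℝ (Fin 3)) | ¬ (∃ b : ℝ, 9 / 10 ≤ b ∧ b ≤ 1 ∧ ∃ (A : EuclideanSpace ℝ (Fin 3) →ₗᵢ[ℝ] EuclideanSpace ℝ (Fin 3)) (s : ℤ → ℤ) (z : ℤ → ℝ),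 Literature.MathematicalPhysics.StatisticalMechanics.IsHaggSeq s ∧ (∀ m : ℤ, 39 / 50 * b ≤ z (m + 1) - z m ∧ z (m + 1) - z m ≤ 17 / 20 * b) ∧ z 0 = 0 ∧ (∀ y : EuclideanSpace ℝ (Fin 3), dist y (0 : EuclideanSpace ℝ (Fin 3)) ≤ 4 * b → μ {y} ≠ 0 → ∃ y' : EuclideanSpace ℝ (Fin 3), y' - (0 : EuclideanSpace ℝ (Fin 3)) ∈ {p | ∃ m i j : ℤ, p = A (((i : ℝ) • Literature.MathematicalPhysics.StatisticalMechanics.triangularVec₁ b) + ((j : ℝ) • Literature.MathematicalPhysics.StatisticalMechanics.triangularVec₂ b) + ((Literature.MathematicalPhysics.StatisticalMechanics.haggLabel s m : ℝ) • Literature.MathematicalPhysics.StatisticalMechanics.barlowOffset b) + (z m • Literature.MathematicalPhysics.StatisticalMechanics.layerNormal 1))} ∧ dist y y' < η) ∧ (∀ y' : EuclideanSpace ℝ (Fin 3), y' - (0 : EuclideanSpace ℝ (Fin 3)) ∈ {p | ∃ m i j : ℤ, p = A (((i : ℝ) • Literature.MathematicalPhysics.StatisticalMechanics.triangularVec₁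 b) + ((j : ℝ) • Literature.MathematicalPhysics.StatisticalMechanics.triangularVec₂ b) + ((Literature.MathematicalPhysics.StatisticalMechanics.haggLabel s m : ℝ) • Literature.MathematicalPhysics.StatisticalMechanics.barlowOffset b) + (z m • Literature.MathematicalPhysics.StatisticalMechanics.layerNormal 1))} → dist y' (0 : EuclideanSpace ℝ (Fin 3)) ≤ 5 * b → ∃ y : EuclideanSpace ℝ (Fin 3), μ {y} ≠ 0 ∧ dist y y' < η))} P) :
    ∀ δ : ℝ, 0 < δ → ∀ P : MeasureTheory.Measure (MeasureTheory.Measure (EuclideanSpace ℝ (Fin 3))), MeasureTheory.IsProbabilityMeasure P → (∀ᵐ μ ∂P, (∃ S : Set (EuclideanSpace ℝ (Fin 3)), (0 : EuclideanSpace ℝ (Fin 3)) ∈ S ∧ (∀ x ∈ S, ∀ y ∈ S, x ≠ y → δ ≤ dist x y) ∧ μ = (MeasureTheory.Measure.count : MeasureTheory.Measure (EuclideanSpace ℝ (Fin 3))).restrict S)) → (∀ g : MeasureTheory.Measure (EuclideanSpace ℝ (Fin 3)) → EuclideanSpace ℝ (Fin 3) → ENNReal, Measurable (Function.uncurry g)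 → ∫⁻ μ, ∫⁻ y, g μ y ∂μ ∂P = ∫⁻ μ, ∫⁻ y, g (MeasureTheory.Measure.map (fun z => z - y) μ) (-y) ∂μ ∂P) → (∀ᵐ μ ∂P, ∀ q : EuclideanSpace ℝ (Fin 3), μ {q} ≠ 0 → (∃ a : ℝ, 9 / 10 ≤ a ∧ a ≤ 1 ∧ ∃ (A : EuclideanSpace ℝ (Fin 3) →ₗᵢ[ℝ] EuclideanSpace ℝ (Fin 3)) (T : Finset (EuclideanSpace ℝ (Fin 3))) (f : EuclideanSpace ℝ (Fin 3) → EuclideanSpace ℝ (Fin 3)), (T = Literature.Geometry.DiscreteGeometry.fccTwoShellPattern ∨ T = Literature.Geometry.DiscreteGeometry.hcpTwoShellPattern) ∧ (∀ v ∈ T, f v ∈ {p : EuclideanSpace ℝ (Fin 3) | μ {p} ≠ 0} ∧ dist (f v) (q + a • A v) ≤ 1 / 16 * a) ∧ Set.InjOn f ↑T ∧ ∀ y ∈ {p : EuclideanSpace ℝ (Fin 3) | μ {p} ≠ 0}, y ≠ q → dist y q < 3 / 2 * a → ∃ v ∈ T, f v = y)) → ∀ η : ℝ, 0 < η → ∀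 n : ℕ, (MeasureTheory.Integrable (fun μ : MeasureTheory.Measure (EuclideanSpace ℝ (Fin 3)) => (((fun f : EuclideanSpace ℝ (Fin 3) → ℝ => fun x : EuclideanSpace ℝ (Fin 3) => (1 / 12 : ℝ) * ∫ y, (if 0 < dist x y ∧ dist x y ≤ 28 / 25 then f y else 0) ∂μ)^[n]) (fun x : EuclideanSpace ℝ (Fin 3) => (∫ y, Literature.MathematicalPhysics.StatisticalMechanics.lennardJones ‖y - x‖ ∂μ) / 2) (0 : EuclideanSpace ℝ (Fin 3)))) P ∧ (∫ μ, (((fun f : EuclideanSpace ℝ (Fin 3) → ℝ => fun x : EuclideanSpace ℝ (Fin 3) => (1 / 12 : ℝ) * ∫ y, (if 0 < dist x y ∧ dist x y ≤ 28 / 25 then f y else 0) ∂μ)^[n]) (fun x : EuclideanSpace ℝ (Fin 3) => (∫ y, Literature.MathematicalPhysics.StatisticalMechanics.lennardJones ‖y - x‖ ∂μ) / 2) (0 : EuclideanSpace ℝ (Fin 3))) ∂P) = (∫ μ, (∫ y, Literature.MathematicalPhysics.StatisticalMechanics.lennardJones ‖y‖ ∂μ) / 2 ∂P)) ∧ (MeasureTheory.Integrable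 (fun μ : MeasureTheory.Measure (EuclideanSpace ℝ (Fin 3)) => (((fun f : EuclideanSpace ℝ (Fin 3) → ℝ => fun x : EuclideanSpace ℝ (Fin 3) => (1 / 12 : ℝ) * ∫ y, (if 0 < dist x y ∧ dist x y ≤ 28 / 25 then f y else 0) ∂μ)^[n]) (fun x : EuclideanSpace ℝ (Fin 3) => Set.indicator {x' : EuclideanSpace ℝ (Fin 3) | ¬ (∃ b : ℝ, 9 / 10 ≤ b ∧ b ≤ 1 ∧ ∃ (A : EuclideanSpace ℝ (Fin 3) →ₗᵢ[ℝ] EuclideanSpace ℝ (Fin 3)) (s : ℤ → ℤ) (z : ℤ → ℝ), Literature.MathematicalPhysics.StatisticalMechanics.IsHaggSeq s ∧ (∀ m : ℤ, 39 / 50 * b ≤ z (m + 1) - z m ∧ z (m + 1) - z m ≤ 17 / 20 * b) ∧ z 0 = 0 ∧ (∀ y : EuclideanSpace ℝ (Fin 3), dist y x' ≤ 4 * b → μ {y} ≠ 0 → ∃ y' : EuclideanSpace ℝ (Fin 3), y' - x' ∈ {p | ∃ m i j : ℤ, p = A (((i : ℝ) • Literature.MathematicalPhysics.StatisticalMechanics.triangularVec₁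 b) + ((j : ℝ) • Literature.MathematicalPhysics.StatisticalMechanics.triangularVec₂ b) + ((Literature.MathematicalPhysics.StatisticalMechanics.haggLabel s m : ℝ) • Literature.MathematicalPhysics.StatisticalMechanics.barlowOffset b) + (z m • Literature.MathematicalPhysics.StatisticalMechanics.layerNormal 1))} ∧ dist y y' < η) ∧ (∀ y' : EuclideanSpace ℝ (Fin 3), y' - x' ∈ {p | ∃ m i j : ℤ, p = A (((i : ℝ) • Literature.MathematicalPhysics.StatisticalMechanics.triangularVec₁ b) + ((j : ℝ) • Literature.MathematicalPhysics.StatisticalMechanics.triangularVec₂ b) + ((Literature.MathematicalPhysics.StatisticalMechanics.haggLabel s m : ℝ) • Literature.MathematicalPhysics.StatisticalMechanics.barlowOffset b) + (z m • Literature.MathematicalPhysics.StatisticalMechanics.layerNormal 1))} → dist y' x' ≤ 5 * b → ∃ y : EuclideanSpace ℝ (Fin 3), μ {y} ≠ 0 ∧ dist y y' < η))} (fun _ => (1 : ℝ)) x) (0 : EuclideanSpace ℝ (Fin 3)))) P ∧ (∫ μ, (((fun f : EuclideanSpace ℝ (Fin 3) → ℝ => fun x : EuclideanSpace ℝ (Fin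 3) => (1 / 12 : ℝ) * ∫ y, (if 0 < dist x y ∧ dist x y ≤ 28 / 25 then f y else 0) ∂μ)^[n]) (fun x : EuclideanSpace ℝ (Fin 3) => Set.indicator {x' : EuclideanSpace ℝ (Fin 3) | ¬ (∃ b : ℝ, 9 / 10 ≤ b ∧ b ≤ 1 ∧ ∃ (A : EuclideanSpace ℝ (Fin 3) →ₗᵢ[ℝ] EuclideanSpace ℝ (Fin 3)) (s : ℤ → ℤ) (z : ℤ → ℝ), Literature.MathematicalPhysics.StatisticalMechanics.IsHaggSeq s ∧ (∀ m : ℤ, 39 / 50 * b ≤ z (m + 1) - z m ∧ z (m + 1) - z m ≤ 17 / 20 * b) ∧ z 0 = 0 ∧ (∀ y : EuclideanSpace ℝ (Fin 3), dist y x' ≤ 4 * b → μ {y} ≠ 0 → ∃ y' : EuclideanSpace ℝ (Fin 3), y' - x' ∈ {p | ∃ m i j : ℤ, p = A (((i : ℝ) • Literature.MathematicalPhysics.StatisticalMechanics.triangularVec₁ b) + ((j : ℝ) • Literature.MathematicalPhysics.StatisticalMechanics.triangularVec₂ b) + ((Literature.MathematicalPhysics.StatisticalMechanics.haggLabel s m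 : ℝ) • Literature.MathematicalPhysics.StatisticalMechanics.barlowOffset b) + (z m • Literature.MathematicalPhysics.StatisticalMechanics.layerNormal 1))} ∧ dist y y' < η) ∧ (∀ y' : EuclideanSpace ℝ (Fin 3), y' - x' ∈ {p | ∃ m i j : ℤ, p = A (((i : ℝ) • Literature.MathematicalPhysics.StatisticalMechanics.triangularVec₁ b) + ((j : ℝ) • Literature.MathematicalPhysics.StatisticalMechanics.triangularVec₂ b) + ((Literature.MathematicalPhysics.StatisticalMechanics.haggLabel s m : ℝ) • Literature.MathematicalPhysics.StatisticalMechanics.barlowOffset b) + (z m • Literature.MathematicalPhysics.StatisticalMechanics.layerNormal 1))} → dist y' x' ≤ 5 * b → ∃ y : EuclideanSpace ℝ (Fin 3), μ {y} ≠ 0 ∧ dist y y' < η))} (fun _ => (1 : ℝ)) x) (0 : EuclideanSpace ℝ (Fin 3))) ∂P) = (P {μ : MeasureTheory.Measure (EuclideanSpace ℝ (Fin 3)) | ¬ (∃ b : ℝ, 9 / 10 ≤ b ∧ b ≤ 1 ∧ ∃ (A : EuclideanSpace ℝ (Fin 3) →ₗᵢ[ℝ] EuclideanSpace ℝ (Fin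 3)) (s : ℤ → ℤ) (z : ℤ → ℝ), Literature.MathematicalPhysics.StatisticalMechanics.IsHaggSeq s ∧ (∀ m : ℤ, 39 / 50 * b ≤ z (m + 1) - z m ∧ z (m + 1) - z m ≤ 17 / 20 * b) ∧ z 0 = 0 ∧ (∀ y : EuclideanSpace ℝ (Fin 3), dist y (0 : EuclideanSpace ℝ (Fin 3)) ≤ 4 * b → μ {y} ≠ 0 → ∃ y' : EuclideanSpace ℝ (Fin 3), y' - (0 : EuclideanSpace ℝ (Fin 3)) ∈ {p | ∃ m i j : ℤ, p = A (((i : ℝ) • Literature.MathematicalPhysics.StatisticalMechanics.triangularVec₁ b) + ((j : ℝ) • Literature.MathematicalPhysics.StatisticalMechanics.triangularVec₂ b) + ((Literature.MathematicalPhysics.StatisticalMechanics.haggLabel s m : ℝ) • Literature.MathematicalPhysics.StatisticalMechanics.barlowOffset b) + (z m • Literature.MathematicalPhysics.StatisticalMechanics.layerNormal 1))} ∧ dist y y' < η) ∧ (∀ y' : EuclideanSpace ℝ (Fin 3), y' - (0 : EuclideanSpace ℝ (Fin 3)) ∈ {p | ∃ m i j : ℤ, p = A (((i : ℝ) • Literature.MathematicalPhysics.StatisticalMechanics.triangularVec₁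 b) + ((j : ℝ) • Literature.MathematicalPhysics.StatisticalMechanics.triangularVec₂ b) + ((Literature.MathematicalPhysics.StatisticalMechanics.haggLabel s m : ℝ) • Literature.MathematicalPhysics.StatisticalMechanics.barlowOffset b) + (z m • Literature.MathematicalPhysics.StatisticalMechanics.layerNormal 1))} → dist y' (0 : EuclideanSpace ℝ (Fin 3)) ≤ 5 * b → ∃ y : EuclideanSpace ℝ (Fin 3), μ {y} ≠ 0 ∧ dist y y' < η))}).toReal) := by
  intro δ hδ P hP hroot hMecke hclean η hη n
  exact ⟨energy_transport_clause hδ P hP hroot hMecke hclean n,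
    defect_transport_clause hδ P hP hroot hMecke hclean (hR δ hδ P hroot η hη) n⟩

/-! ## The stub `stub_walkTransportEnvS` (Tc̄ˢ) — unconditional -/

/-- **Stub Tc̄ˢ `stub_walkTransportEnvS`** of the registered skeleton `ChartedZeroExcessLayered_window_birth.lean`
(sha256 660351068daaba86, stmt-AtomisticToContinuum-26636), BY NAME AND SIGNATURE: for a point-stationary law of the envelope
class the `n`-step bond walk transports the root energy (A) and the strict `η`-defect indicator (D), for every `η > 0` and
every `n`.  Proof: `tcEnvS_of_defectEventNullMeasurable` fed with the PROVED residual
`ChartedPlanarOrderDefectEventMeasurable.defectEventNullMeasurable`. -/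
theorem stub_walkTransportEnvS : ∀ δ : ℝ, 0 < δ → ∀ P : MeasureTheory.Measure (MeasureTheory.Measure (EuclideanSpace ℝ (Fin 3))), MeasureTheory.IsProbabilityMeasure P → (∀ᵐ μ ∂P, (∃ S : Set (EuclideanSpace ℝ (Fin 3)), (0 : EuclideanSpace ℝ (Fin 3)) ∈ S ∧ (∀ x ∈ S, ∀ y ∈ S, x ≠ y → δ ≤ dist x y) ∧ μ = (MeasureTheory.Measure.count : MeasureTheory.Measure (EuclideanSpace ℝ (Fin 3))).restrict S)) → (∀ g : MeasureTheory.Measure (EuclideanSpace ℝ (Fin 3)) → EuclideanSpace ℝ (Fin 3) → ENNReal, Measurable (Function.uncurry g) → ∫⁻ μ, ∫⁻ y, g μ y ∂μ ∂P = ∫⁻ μ, ∫⁻ y, g (MeasureTheory.Measure.map (fun z => z - y) μ) (-y) ∂μ ∂P) → (∀ᵐ μ ∂P, ∀ q : EuclideanSpace ℝ (Fin 3), μ {q} ≠ 0 → (∃ a : ℝ, 9 / 10 ≤ a ∧ a ≤ 1 ∧ ∃ (A : EuclideanSpace ℝ (Fin 3) →ₗᵢ[ℝ] EuclideanSpace ℝ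 (Fin 3)) (T : Finset (EuclideanSpace ℝ (Fin 3))) (f : EuclideanSpace ℝ (Fin 3) → EuclideanSpace ℝ (Fin 3)), (T = Literature.Geometry.DiscreteGeometry.fccTwoShellPattern ∨ T = Literature.Geometry.DiscreteGeometry.hcpTwoShellPattern) ∧ (∀ v ∈ T, f v ∈ {p : EuclideanSpace ℝ (Fin 3) | μ {p} ≠ 0} ∧ dist (f v) (q + a • A v) ≤ 1 / 16 * a) ∧ Set.InjOn f ↑T ∧ ∀ y ∈ {p : EuclideanSpace ℝ (Fin 3) | μ {p} ≠ 0}, y ≠ q → dist y q < 3 / 2 * a → ∃ v ∈ T, f v = y)) → ∀ η : ℝ, 0 < η → ∀ n : ℕ, (MeasureTheory.Integrable (fun μ : MeasureTheory.Measure (EuclideanSpace ℝ (Fin 3)) => (((fun f : EuclideanSpace ℝ (Fin 3) → ℝ => fun x : EuclideanSpace ℝ (Fin 3) => (1 / 12 : ℝ) * ∫ y, (if 0 < dist x y ∧ dist x y ≤ 28 / 25 then f y else 0) ∂μ)^[n]) (fun x : EuclideanSpace ℝ (Fin 3) => (∫ y, Literature.MathematicalPhysics.StatisticalMechanics.lennardJones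 ‖y - x‖ ∂μ) / 2) (0 : EuclideanSpace ℝ (Fin 3)))) P ∧ (∫ μ, (((fun f : EuclideanSpace ℝ (Fin 3) → ℝ => fun x : EuclideanSpace ℝ (Fin 3) => (1 / 12 : ℝ) * ∫ y, (if 0 < dist x y ∧ dist x y ≤ 28 / 25 then f y else 0) ∂μ)^[n]) (fun x : EuclideanSpace ℝ (Fin 3) => (∫ y, Literature.MathematicalPhysics.StatisticalMechanics.lennardJones ‖y - x‖ ∂μ) / 2) (0 : EuclideanSpace ℝ (Fin 3))) ∂P) = (∫ μ, (∫ y, Literature.MathematicalPhysics.StatisticalMechanics.lennardJones ‖y‖ ∂μ) / 2 ∂P)) ∧ (MeasureTheory.Integrable (fun μ : MeasureTheory.Measure (EuclideanSpace ℝ (Fin 3)) => (((fun f : EuclideanSpace ℝ (Fin 3) → ℝ => fun x : EuclideanSpace ℝ (Fin 3) => (1 / 12 : ℝ) * ∫ y, (if 0 < dist x y ∧ dist x y ≤ 28 / 25 then f y else 0) ∂μ)^[n]) (fun x : EuclideanSpace ℝ (Fin 3) => Set.indicator {x' : EuclideanSpace ℝ (Fin 3) | ¬ (∃ b : ℝ,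 9 / 10 ≤ b ∧ b ≤ 1 ∧ ∃ (A : EuclideanSpace ℝ (Fin 3) →ₗᵢ[ℝ] EuclideanSpace ℝ (Fin 3)) (s : ℤ → ℤ) (z : ℤ → ℝ), Literature.MathematicalPhysics.StatisticalMechanics.IsHaggSeq s ∧ (∀ m : ℤ, 39 / 50 * b ≤ z (m + 1) - z m ∧ z (m + 1) - z m ≤ 17 / 20 * b) ∧ z 0 = 0 ∧ (∀ y : EuclideanSpace ℝ (Fin 3), dist y x' ≤ 4 * b → μ {y} ≠ 0 → ∃ y' : EuclideanSpace ℝ (Fin 3), y' - x' ∈ {p | ∃ m i j : ℤ, p = A (((i : ℝ) • Literature.MathematicalPhysics.StatisticalMechanics.triangularVec₁ b) + ((j : ℝ) • Literature.MathematicalPhysics.StatisticalMechanics.triangularVec₂ b) + ((Literature.MathematicalPhysics.StatisticalMechanics.haggLabel s m : ℝ) • Literature.MathematicalPhysics.StatisticalMechanics.barlowOffset b) + (z m • Literature.MathematicalPhysics.StatisticalMechanics.layerNormal 1))} ∧ dist y y' < η) ∧ (∀ y' : EuclideanSpace ℝ (Fin 3), y' - x' ∈ {p | ∃ m i j : ℤ,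 p = A (((i : ℝ) • Literature.MathematicalPhysics.StatisticalMechanics.triangularVec₁ b) + ((j : ℝ) • Literature.MathematicalPhysics.StatisticalMechanics.triangularVec₂ b) + ((Literature.MathematicalPhysics.StatisticalMechanics.haggLabel s m : ℝ) • Literature.MathematicalPhysics.StatisticalMechanics.barlowOffset b) + (z m • Literature.MathematicalPhysics.StatisticalMechanics.layerNormal 1))} → dist y' x' ≤ 5 * b → ∃ y : EuclideanSpace ℝ (Fin 3), μ {y} ≠ 0 ∧ dist y y' < η))} (fun _ => (1 : ℝ)) x) (0 : EuclideanSpace ℝ (Fin 3)))) P ∧ (∫ μ, (((fun f : EuclideanSpace ℝ (Fin 3) → ℝ => fun x : EuclideanSpace ℝ (Fin 3) => (1 / 12 : ℝ) * ∫ y, (if 0 < dist x y ∧ dist x y ≤ 28 / 25 then f y else 0) ∂μ)^[n]) (fun x : EuclideanSpace ℝ (Fin 3) => Set.indicator {x' : EuclideanSpace ℝ (Fin 3) | ¬ (∃ b : ℝ, 9 / 10 ≤ b ∧ b ≤ 1 ∧ ∃ (A : EuclideanSpace ℝ (Fin 3) →ₗᵢ[ℝ] EuclideanSpace ℝ (Fin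 3)) (s : ℤ → ℤ) (z : ℤ → ℝ), Literature.MathematicalPhysics.StatisticalMechanics.IsHaggSeq s ∧ (∀ m : ℤ, 39 / 50 * b ≤ z (m + 1) - z m ∧ z (m + 1) - z m ≤ 17 / 20 * b) ∧ z 0 = 0 ∧ (∀ y : EuclideanSpace ℝ (Fin 3), dist y x' ≤ 4 * b → μ {y} ≠ 0 → ∃ y' : EuclideanSpace ℝ (Fin 3), y' - x' ∈ {p | ∃ m i j : ℤ, p = A (((i : ℝ) • Literature.MathematicalPhysics.StatisticalMechanics.triangularVec₁ b) + ((j : ℝ) • Literature.MathematicalPhysics.StatisticalMechanics.triangularVec₂ b) + ((Literature.MathematicalPhysics.StatisticalMechanics.haggLabel s m : ℝ) • Literature.MathematicalPhysics.StatisticalMechanics.barlowOffset b) + (z m • Literature.MathematicalPhysics.StatisticalMechanics.layerNormal 1))} ∧ dist y y' < η) ∧ (∀ y' : EuclideanSpace ℝ (Fin 3), y' - x' ∈ {p | ∃ m i j : ℤ, p = A (((i : ℝ) • Literature.MathematicalPhysics.StatisticalMechanics.triangularVec₁ b) + ((j : ℝ) • Literature.MathematicalPhysics.StatisticalMechanics.triangularVec₂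 b) + ((Literature.MathematicalPhysics.StatisticalMechanics.haggLabel s m : ℝ) • Literature.MathematicalPhysics.StatisticalMechanics.barlowOffset b) + (z m • Literature.MathematicalPhysics.StatisticalMechanics.layerNormal 1))} → dist y' x' ≤ 5 * b → ∃ y : EuclideanSpace ℝ (Fin 3), μ {y} ≠ 0 ∧ dist y y' < η))} (fun _ => (1 : ℝ)) x) (0 : EuclideanSpace ℝ (Fin 3))) ∂P) = (P {μ : MeasureTheory.Measure (EuclideanSpace ℝ (Fin 3)) | ¬ (∃ b : ℝ, 9 / 10 ≤ b ∧ b ≤ 1 ∧ ∃ (A : EuclideanSpace ℝ (Fin 3) →ₗᵢ[ℝ] EuclideanSpace ℝ (Fin 3)) (s : ℤ → ℤ) (z : ℤ → ℝ), Literature.MathematicalPhysics.StatisticalMechanics.IsHaggSeq s ∧ (∀ m : ℤ, 39 / 50 * b ≤ z (m + 1) - z m ∧ z (m + 1) - z m ≤ 17 / 20 * b) ∧ z 0 = 0 ∧ (∀ y : EuclideanSpace ℝ (Fin 3), dist y (0 : EuclideanSpace ℝ (Fin 3)) ≤ 4 * b → μ {y} ≠ 0 → ∃ y' : EuclideanSpace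 ℝ (Fin 3), y' - (0 : EuclideanSpace ℝ (Fin 3)) ∈ {p | ∃ m i j : ℤ, p = A (((i : ℝ) • Literature.MathematicalPhysics.StatisticalMechanics.triangularVec₁ b) + ((j : ℝ) • Literature.MathematicalPhysics.StatisticalMechanics.triangularVec₂ b) + ((Literature.MathematicalPhysics.StatisticalMechanics.haggLabel s m : ℝ) • Literature.MathematicalPhysics.StatisticalMechanics.barlowOffset b) + (z m • Literature.MathematicalPhysics.StatisticalMechanics.layerNormal 1))} ∧ dist y y' < η) ∧ (∀ y' : EuclideanSpace ℝ (Fin 3), y' - (0 : EuclideanSpace ℝ (Fin 3)) ∈ {p | ∃ m i j : ℤ, p = A (((i : ℝ) • Literature.MathematicalPhysics.StatisticalMechanics.triangularVec₁ b) + ((j : ℝ) • Literature.MathematicalPhysics.StatisticalMechanics.triangularVec₂ b) + ((Literature.MathematicalPhysics.StatisticalMechanics.haggLabel s m : ℝ) • Literature.MathematicalPhysics.StatisticalMechanics.barlowOffset b) + (z m • Literature.MathematicalPhysics.StatisticalMechanics.layerNormal 1))} → dist y' (0 : EuclideanSpace ℝ (Fin 3)) ≤ 5 * b → ∃ y : EuclideanSpace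 ℝ (Fin 3), μ {y} ≠ 0 ∧ dist y y' < η))}).toReal) :=
  tcEnvS_of_defectEventNullMeasurable
    Summit.AtomisticToContinuum.Crystallization.Theorems.ChartedPlanarOrderDefectEventMeasurable.defectEventNullMeasurable

end Summit.AtomisticToContinuum.Crystallization.Theorems.ChartedPlanarOrderEnvelopeTransport
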